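import Summits.BirchSwinnertonDyer.BirchSwinnertonDyer.Theorems.ResidualThetaTransportAtTwoResidualThetaMainConjectureAtTwoMazurTateLayer
import Summits.BirchSwinnertonDyer.Rank1Residual.Supersingular.MazurTateLayerConsistency
import Summits.BirchSwinnertonDyer.Rank1Residual.Supersingular.MazurTateReduction
import Summits.BirchSwinnertonDyer.Rank1Residual.Supersingular.KobayashiMainConjecture
import HarnessLib

/-!
# Route `SignedLowerHalves`, crux L `SmallImageLowerHalfBothSigns` (item stmt-BirchSwinnertonDyer-23599), line `rtt_w3` v3,
# stub AN_W `stub_layerLambdaDepleted_ns`: the UNDEPLETED layer law at every prime `p` and both parities —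
# `λ_n(θ_n(f)) = deg ω_n^{−ε} + λ(L^ε)` for `n` of the parity of `ε` under the headroom `deg ω_n^{−ε} + λ(L^ε) < pⁿ`

LEAD `cruxlead-stmt-BirchSwinnertonDyer-23599` g0 (cell `bsd-ssimc`); ROUTE-INDEPENDENT helper (`--supports
stmt-BirchSwinnertonDyer-23599`); THEOREMS ONLY — no definition, no named fact, no `sorry`; closes nothing; BSD is not proved
by any of this.

HONEST FRAMING. The v3 stub AN_W of line `rtt_w3` asks, for the conductor-level newform `f` of `W`, a Pollack pair
`(L⁺, L⁻)` and a finite `S₀ ∌ p`, for the layer-`λ` of the `S₀`-DEPLETED Mazur–Tate element at the layers of the parity of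
`ε`: `λ_n(θ^{S₀}_n(f)) = λ(L^ε) + Σ_v λ_n(𝒫^{(n)}_v) + deg ω_n^{−ε}` (`n ≫ 0`). This file proves its `S₀ = ∅` CORE at every
prime `p` (the tree had it at `p = 2`, even layers: `ResidualThetaLayer.layerLambda_mazurTateElement_two_of_isPollackPair`):
from the Pollack congruences `θ_n ≡ (−1)^{⌊n/2⌋+1} ω_n^± L^± (mod ω_n)` (`IsPollackPair`, Pollack 2003 Prop 6.18), the reductions
`ω_n^± ≡ X^{deg ω_n^±} (mod p)` and the tree's integral-model lemma `ResidualThetaLayer.exists_integralModel_of_isCongrModOmega`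
(Weierstrass division by `ω_n ≡ X^{pⁿ}`), for EVERY layer `n` of the parity of `ε` with the headroom
`deg ω_n^{−ε} + λ(L^ε) < pⁿ`, and hence for all `n ≥ 2·λ(L^ε) + 2` of that parity. The depletion factors (Gauss's lemma +
the layer product rule `layerLambda_mul_modByMonic_layerModulus` + the Euler-factor layer orders at odd `p`) are the remaining,
separate part of AN_W.

* §1 `map_zmod_cyclotomicOmegaPlus`, `map_zmod_cyclotomicOmegaMinus` — `ω_n^± mod p = X^{deg ω_n^±}` (as `ZMod p`-polynomials).
* §2 `layerLambda_mazurTateElement_of_isCongrModOmega` — the abstract law: a congruence `θ_n ≡ u·ω·L (mod ω_n)` with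
  `ω̄ = X^d`, `L ≠ 0`, `d + λ(L) < pⁿ` gives `λ_n(θ_n) = d + λ(L)` (any `p`).
* §3 `layerLambda_mazurTateElement_of_isPollackPair` — `λ_n(θ_n(f)) = deg ω_n^{−ε} + λ(L^ε)` at a layer of the parity of
  `ε` inside the headroom; `headroom_of_le` — the headroom holds for `n ≥ 2·λ(L^ε) + 2`;
  `eventually_layerLambda_mazurTateElement_of_isPollackPair` — the `∃ n₀` form (= AN_W with `S₀ = ∅`).

References: [Pollack2003] Prop. 6.18, §6.5; [PollackWeston2011MT] §3.1, Thm. 4.1 (`q_n = deg ω_n^{−ε}`); [Kurihara2002];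
[Washington1997] §7.1.
-/

set_option autoImplicit false
-- D-0017: single-problem summit, the namespace repeats the problem name by design.
set_option linter.dupNamespace false
noncomputable section

open scoped Classical MatrixGroups ModularForm

open Polynomial Literature.NumberTheory.EllipticCurves Literature.NumberTheory.IwasawaTheory
  Summit.BirchSwinnertonDyer.Rank1Residual.X1.MuLambda Summit.BirchSwinnertonDyer.Rank1Residual.Supersingular
  Summit.BirchSwinnertonDyer.BirchSwinnertonDyer.Theorems.ResidualThetaLayer

namespace Summit.BirchSwinnertonDyer.BirchSwinnertonDyer.Theorems.SmallImageRttOneSided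

variable {p : ℕ} [hp : Fact p.Prime]

/-! ## §1 `ω_n^± mod p = X^{deg ω_n^±}` -/

section Omega

/-- `Φ_{p^m}(X+1) ≡ X^{p^m − p^{m−1}} (mod p)` for `m ≥ 1`. [cite: Pollack2003, §6.5] -/
theorem map_zmod_cyclotomic_prime_pow_comp {m : ℕ} (hm : 0 < m) :
    ((cyclotomic (p ^ m) ℤ).comp (X + 1)).map (Int.castRingHom (ZMod p)) = X ^ (p ^ m - p ^ (m - 1)) := by
  rw [Polynomial.map_comp, map_cyclotomic, Polynomial.map_add, Polynomial.map_X, Polynomial.map_one,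
    show p ^ m = p ^ m * 1 from (mul_one _).symm,
    cyclotomic_mul_prime_pow_eq (ZMod p) (fun h ↦ hp.out.one_lt.ne' (Nat.dvd_one.mp h)) hm,
    cyclotomic_one, pow_comp, sub_comp, X_comp, one_comp, add_sub_cancel_right, mul_one]

/-- **`ω_n^+ ≡ X^{deg ω_n^+} (mod p)`** (each factor `Φ_{p^{2k}}(X+1)` is `X^{φ(p^{2k})}` mod `p`; `ω_n^+` is monic, so the
exponent is its degree). [cite: Pollack2003, §6.5 (display before Prop. 6.18)] -/
theorem map_zmod_cyclotomicOmegaPlus (n : ℕ) :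
    (cyclotomicOmegaPlus p n).map (Int.castRingHom (ZMod p)) = X ^ (cyclotomicOmegaPlus p n).natDegree := by
  have key : (cyclotomicOmegaPlus p n).map (Int.castRingHom (ZMod p)) =
      X ^ (∑ k ∈ Finset.Icc 1 (n / 2), (p ^ (2 * k) - p ^ (2 * k - 1))) := by
    rw [cyclotomicOmegaPlus, Polynomial.map_prod, ← Finset.prod_pow_eq_pow_sum]
    refine Finset.prod_congr rfl fun k hk ↦ ?_
    rw [Finset.mem_Icc] at hk
    rw [map_zmod_cyclotomic_prime_pow_comp (by omega)]
  have hdeg := congrArg natDegree key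
  rw [(monic_cyclotomicOmegaPlus p n).natDegree_map, natDegree_X_pow] at hdeg
  rw [key, hdeg]

/-- **`ω_n^- ≡ X^{deg ω_n^-} (mod p)`.** [cite: Pollack2003, §6.5 (display before Prop. 6.18)] -/
theorem map_zmod_cyclotomicOmegaMinus (n : ℕ) :
    (cyclotomicOmegaMinus p n).map (Int.castRingHom (ZMod p)) = X ^ (cyclotomicOmegaMinus p n).natDegree := by
  have key : (cyclotomicOmegaMinus p n).map (Int.castRingHom (ZMod p)) =
      X ^ (∑ k ∈ Finset.Icc 1 ((n + 1) / 2), (p ^ (2 * k - 1) - p ^ (2 * k - 1 - 1))) := by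
    rw [cyclotomicOmegaMinus, Polynomial.map_prod, ← Finset.prod_pow_eq_pow_sum]
    refine Finset.prod_congr rfl fun k hk ↦ ?_
    rw [Finset.mem_Icc] at hk
    rw [map_zmod_cyclotomic_prime_pow_comp (by omega)]
  have hdeg := congrArg natDegree key
  rw [(monic_cyclotomicOmegaMinus p n).natDegree_map, natDegree_X_pow] at hdeg
  rw [key, hdeg]

/-- The signed reduction `((−1)^e · ω) mod p = C((−1)^e) · X^{deg ω}` for `ω ∈ {ω_n^+, ω_n^-}`. [folklore] -/
theorem map_zmod_neg_one_pow_mul {ω : ℤ[X]} {d : ℕ} (hω : ω.map (Int.castRingHom (ZMod p)) = X ^ d) (e : ℕ) :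
    ((-1) ^ e * ω).map (Int.castRingHom (ZMod p)) = C ((-1 : ZMod p) ^ e) * X ^ d := by
  rw [Polynomial.map_mul, Polynomial.map_pow, Polynomial.map_neg, Polynomial.map_one, hω, map_pow, map_neg, C_1]

end Omega

/-! ## §2 The abstract layer law from a congruence mod `ω_n` -/

section Abstract

/-- The embedding `ℤ_p → ℚ_p → ℚ̄_p` preserves norms. [folklore] -/
theorem norm_algebraMap_comp_padicInt (x : ℤ_[p]) :
    ‖((algebraMap ℚ_[p] (PadicAlgCl p)).comp (algebraMap ℤ_[p] ℚ_[p])) x‖ = ‖x‖ := by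
  rw [RingHom.comp_apply, PadicInt.algebraMap_apply]
  exact (PadicAlgCl.norm_extends p (x : ℚ_[p])).trans (PadicInt.padic_norm_e_of_padicInt x)

/-- **The layer law from a congruence** (any prime `p`): if `θ_n(f) ≡ (−1)^e ω L (mod ω_n)` in `Λ ⊗ ℚ_p`
(`IsCongrModOmega`), `ω ≡ X^d (mod p)`, `L ≠ 0` and `d + λ(L) < pⁿ`, then the layer-`λ` (Pollack–Weston §3.1) of `θ_n(f)` read in
`ℚ̄_p[X]` is `d + λ(L)`. Port to every `p` of the tree's `p = 2` reading `layerLambda_mazurTateElement_two_of_isPollackPair`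
(integral model by `exists_integralModel_of_isCongrModOmega`, then `layerLambda_map_eq_of_order`).
[cite: Pollack2003, Prop. 6.18 and Prop. 6.9] [cite: PollackWeston2011MT, §3.1 and Thm. 4.1] -/
theorem layerLambda_mazurTateElement_of_isCongrModOmega {N : ℕ} (f : CuspForm (CongruenceSubgroup.Gamma0 N) 2)
    {n : ℕ} {ω : ℤ[X]} {d : ℕ} (hω : ω.map (Int.castRingHom (ZMod p)) = X ^ d) (e : ℕ)
    {L : IwasawaAlgebra p} (hL : L ≠ 0) (hcong : IsCongrModOmega p n (mazurTateElement f p n) ((-1) ^ e * ω) L)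
    (hd : d + lam L < p ^ n) :
    layerLambda ((mazurTateElement f p n).map (algebraMap ℚ (PadicAlgCl p))) = d + lam L := by
  set φ : ℤ_[p] →+* PadicAlgCl p := (algebraMap ℚ_[p] (PadicAlgCl p)).comp (algebraMap ℤ_[p] ℚ_[p]) with hφdef
  have hφ : ∀ x, ‖φ x‖ = ‖x‖ := norm_algebraMap_comp_padicInt
  have hu : ((-1 : ZMod p) ^ e) ≠ 0 := pow_ne_zero _ (neg_ne_zero.mpr one_ne_zero)
  have hθcoeff : ∀ i, p ^ n ≤ i → (mazurTateElement f p n).coeff i = 0 := fun i hi ↦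
    coeff_eq_zero_of_natDegree_lt (lt_of_lt_of_le (natDegree_mazurTateElement_lt f p n) hi)
  obtain ⟨P, μ, hθP, hordP⟩ :=
    exists_integralModel_of_isCongrModOmega hcong hL hθcoeff (map_zmod_neg_one_pow_mul hω e) hu hd
  have hφrat : (algebraMap ℚ_[p] (PadicAlgCl p)).comp (algebraMap ℚ ℚ_[p]) = algebraMap ℚ (PadicAlgCl p) :=
    RingHom.ext_rat _ _
  have hp0 : (p : PadicAlgCl p) ≠ 0 := by exact_mod_cast hp.out.ne_zero
  have hθmap : (mazurTateElement f p n).map (algebraMap ℚ (PadicAlgCl p)) =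
      C ((p : PadicAlgCl p) ^ μ) * P.map φ := by
    rw [← hφrat, ← Polynomial.map_map, hθP, Polynomial.map_mul, Polynomial.map_C, map_pow, map_natCast,
      Polynomial.map_map]
  rw [hθmap, layerLambda_C_mul (pow_ne_zero _ hp0), (layerLambda_map_eq_of_order φ hφ hordP).1]

end Abstract

/-! ## §3 The law for a Pollack pair, at the layers of the parity of `ε` -/

section Pollack

/-- **`λ_n(θ_n(f)) = deg ω_n^{−ε} + λ(L^ε)` at a layer `n` of the parity of `ε` inside the headroom.** For a weight-2 cusp
form `f` on `Γ₀(N)` with a Pollack pair `(L⁺, L⁻)` at `p` (`IsPollackPair f p L⁺ L⁻`) and a sign `ε` (Kobayashi's labelling: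
`ε = 1` ↔ even `n` ↔ `L^ε = L⁻`, `ω_n^{−ε} = ω_n^-`; `ε = −1` ↔ odd `n` ↔ `L⁺`, `ω_n^+`): if `Even n ↔ ε = 1` and
`deg ω_n^{−ε} + λ(L^ε) < pⁿ` then `λ_n(θ_n(f)) = deg ω_n^{−ε} + λ(L^ε)` (Kurihara's `q_n + λ` law, `q_n = deg ω_n^{−ε}`).
[cite: Pollack2003, Prop. 6.18] [cite: PollackWeston2011MT, Thm. 4.1] -/
theorem layerLambda_mazurTateElement_of_isPollackPair {N : ℕ} (f : CuspForm (CongruenceSubgroup.Gamma0 N) 2)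
    {Lplus Lminus : IwasawaAlgebra p} (hPP : IsPollackPair f p Lplus Lminus) (ε : ℤˣ) {n : ℕ}
    (hpar : Even n ↔ ε = 1)
    (hn : (if ε = 1 then cyclotomicOmegaMinus p n else cyclotomicOmegaPlus p n).natDegree +
      lam (kobayashiL ε Lplus Lminus) < p ^ n) :
    layerLambda ((mazurTateElement f p n).map (algebraMap ℚ (PadicAlgCl p))) =
      (if ε = 1 then cyclotomicOmegaMinus p n else cyclotomicOmegaPlus p n).natDegree +
        lam (kobayashiL ε Lplus Lminus) := by
  rcases Int.units_eq_one_or ε with rfl | rfl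
  · -- `ε = 1`: even layers, `ω_n^-`, `L⁻`
    have heven : Even n := hpar.mpr rfl
    simp only [if_true, kobayashiL] at hn ⊢
    exact layerLambda_mazurTateElement_of_isCongrModOmega f (map_zmod_cyclotomicOmegaMinus n) (n / 2 + 1)
      hPP.2.1 (hPP.2.2.2 n heven) hn
  · -- `ε = −1`: odd layers, `ω_n^+`, `L⁺`
    have hne : (-1 : ℤˣ) ≠ 1 := by decide
    have hodd : Odd n := Nat.not_even_iff_odd.mp fun h ↦ hne (hpar.mp h)
    simp only [hne, if_false, kobayashiL] at hn ⊢
    exact layerLambda_mazurTateElement_of_isCongrModOmega f (map_zmod_cyclotomicOmegaPlus n) (n / 2 + 1)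
      hPP.1 (hPP.2.2.1 n hodd) hn

omit hp in
/-- Each factor `Φ_{p^j}(X+1)` (`j ≥ 1`) of `ω_n^±` is monic of degree `φ(p^j) ≥ 1`. [cite: Pollack2003, §6.5] -/
theorem monic_cyclotomic_comp_X_add_one (j : ℕ) : ((cyclotomic (p ^ j) ℤ).comp (X + 1)).Monic := by
  have h1 : (X + 1 : ℤ[X]) = X + C 1 := by rw [C_1]
  refine (cyclotomic.monic _ ℤ).comp ?_ ?_
  · rw [h1]; exact monic_X_add_C 1
  · rw [h1, natDegree_X_add_C]; exact one_ne_zero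

/-- `deg Φ_{p^j}(X+1) = φ(p^j) ≥ 1`. [cite: Pollack2003, §6.5] -/
theorem one_le_natDegree_cyclotomic_comp_X_add_one (j : ℕ) :
    1 ≤ ((cyclotomic (p ^ j) ℤ).comp (X + 1)).natDegree := by
  have h1 : (X + 1 : ℤ[X]) = X + C 1 := by rw [C_1]
  rw [natDegree_comp, natDegree_cyclotomic, h1, natDegree_X_add_C, mul_one]
  exact Nat.totient_pos.mpr (pow_pos hp.out.pos j)

/-- `⌊n/2⌋ ≤ deg ω_n^+` and `⌊(n+1)/2⌋ ≤ deg ω_n^-` (one unit of degree per cyclotomic factor). [cite: Pollack2003, §6.5] -/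
theorem half_le_natDegree_cyclotomicOmega (n : ℕ) :
    n / 2 ≤ (cyclotomicOmegaPlus p n).natDegree ∧ (n + 1) / 2 ≤ (cyclotomicOmegaMinus p n).natDegree := by
  constructor
  · rw [cyclotomicOmegaPlus, natDegree_prod_of_monic _ _ (fun k _ ↦ monic_cyclotomic_comp_X_add_one (2 * k))]
    calc n / 2 = ∑ _k ∈ Finset.Icc 1 (n / 2), 1 := by simp
      _ ≤ _ := Finset.sum_le_sum fun k _ ↦ one_le_natDegree_cyclotomic_comp_X_add_one (2 * k)
  · rw [cyclotomicOmegaMinus,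
      natDegree_prod_of_monic _ _ (fun k _ ↦ monic_cyclotomic_comp_X_add_one (2 * k - 1))]
    calc (n + 1) / 2 = ∑ _k ∈ Finset.Icc 1 ((n + 1) / 2), 1 := by simp
      _ ≤ _ := Finset.sum_le_sum fun k _ ↦ one_le_natDegree_cyclotomic_comp_X_add_one (2 * k - 1)

/-- **Headroom for large layers**: `deg ω_n^{−ε} + B < pⁿ` as soon as `2B + 2 ≤ n` (since `1 + deg ω_n^+ + deg ω_n^- = pⁿ`
and each of `ω_n^±` has at least `⌊n/2⌋` cyclotomic factors of positive degree). [cite: Pollack2003, §6.5] -/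
theorem natDegree_omega_add_lt_pow {B n : ℕ} (hn : 2 * B + 2 ≤ n) (ε : ℤˣ) :
    (if ε = 1 then cyclotomicOmegaMinus p n else cyclotomicOmegaPlus p n).natDegree + B < p ^ n := by
  have hsum := natDegree_cyclotomicOmegaPlus_add (p := p) n
  obtain ⟨hplus, hminus⟩ := half_le_natDegree_cyclotomicOmega (p := p) n
  split_ifs <;> omega

/-- **AN_W with `S₀ = ∅`, eventually**: for a Pollack pair of `f` at `p` and a sign `ε` there is `n₀` (namely
`2·λ(L^ε) + 2`) such that `λ_n(θ_n(f)) = deg ω_n^{−ε} + λ(L^ε)` for every `n ≥ n₀` of the parity of `ε`.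
[cite: Pollack2003, Prop. 6.18] [cite: PollackWeston2011MT, Thm. 4.1] -/
theorem eventually_layerLambda_mazurTateElement_of_isPollackPair {N : ℕ}
    (f : CuspForm (CongruenceSubgroup.Gamma0 N) 2) {Lplus Lminus : IwasawaAlgebra p}
    (hPP : IsPollackPair f p Lplus Lminus) (ε : ℤˣ) :
    ∃ n₀ : ℕ, ∀ n ≥ n₀, (Even n ↔ ε = 1) →
      layerLambda ((mazurTateElement f p n).map (algebraMap ℚ (PadicAlgCl p))) =
        (if ε = 1 then cyclotomicOmegaMinus p n else cyclotomicOmegaPlus p n).natDegree +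
          lam (kobayashiL ε Lplus Lminus) :=
  ⟨2 * lam (kobayashiL ε Lplus Lminus) + 2, fun _ hn hpar ↦
    layerLambda_mazurTateElement_of_isPollackPair f hPP ε hpar (natDegree_omega_add_lt_pow hn ε)⟩

end Pollack

end Summit.BirchSwinnertonDyer.BirchSwinnertonDyer.Theorems.SmallImageRttOneSided

end
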